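import Mathlib
import HarnessLib
import Summits.ValiantsHypothesis.ValiantsHypothesis.Theses.MonotoneRestoration
import Literature.Computability.AlgebraicComplexity.ArithCircuit
import Literature.Computability.AlgebraicComplexity.ArithCircuitProofs
import Literature.Computability.AlgebraicComplexity.MonotoneStructure
import Literature.Computability.AlgebraicComplexity.PermanentIrreducible
import Literature.ModelTheory.FiniteModelTheory.CkEquiv
import Summits.ValiantsHypothesis.ValiantsHypothesis.Theorems.MonotoneRestorationMonotoneRestorationQPCosetCount
import Summits.ValiantsHypothesis.ValiantsHypothesis.Theorems.MonotoneRestorationMonotoneRestorationQPSymmetricLB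
import Summits.ValiantsHypothesis.ValiantsHypothesis.Theorems.MonotoneRestorationMonotoneRestorationQPSupportSymmetrisation
import Summits.ValiantsHypothesis.ValiantsHypothesis.Theorems.MonotoneRestorationMonotoneRestorationQPSparseRegime
import Summits.ValiantsHypothesis.ValiantsHypothesis.Theorems.MonotoneRestorationMonotoneRestorationQPBeta
import Literature.Computability.AlgebraicComplexity.SymmetricArithCircuit
import Literature.Computability.AlgebraicComplexity.DawarWilsenach2025Proofs
import Literature.GroupTheory.PermutationGroups.SmallIndexSubgroups
import Summits.ValiantsHypothesis.ValiantsHypothesis.Theorems.MonotoneRestorationQP.Negative.LoadBearing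
import Summits.ValiantsHypothesis.ValiantsHypothesis.Theorems.MonotoneRestorationMonotoneRestorationQPPermSupportCount

/-! TTRL-lite variant V20077 of stmt-ValiantsHypothesis-15886

Target `stub_symmetricMonotone_choose_le_card` (move `lemma_proposal`, the `hmdeg` have-step):
if `f` is homogeneous of degree `d` and every monomial `m` of `q` extended by the fixed context
monomial `μ` lies in the support of `f`, then `deg m + deg μ = d` for every `m ∈ supp q`
(the degree bookkeeping behind the "degree drop" at a gate whose context has degree `≤ k - 1`).
-/

-- `Summit.ValiantsHypothesis.ValiantsHypothesis.…` is the tree's mandated single-conjunct layout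
-- (Sub = Summit), so the duplicated namespace component is intended.
set_option linter.dupNamespace false

namespace Summit.ValiantsHypothesis.ValiantsHypothesis.Theorems

open Summit.ValiantsHypothesis.ValiantsHypothesis.Theses.MonotoneRestoration
open Literature.Computability.AlgebraicComplexity

/-- **TTRL-lite variant V20077 of `stub_symmetricMonotone_choose_le_card`** (degree bookkeeping
of a gate context): for `f` homogeneous of degree `d`, if every monomial `m` of `q` satisfies
`m + μ ∈ f.support` for a fixed exponent vector `μ`, then `m.degree + μ.degree = d` on `q.support`.
Proof: homogeneity gives `weight 1 (m + μ) = d`, i.e. `(m + μ).degree = d`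
(`Finsupp.degree_eq_weight_one`), and `Finsupp.degree` is additive. -/
theorem stub_symmetricMonotone_choose_le_card_var20077 :
    ∀ (n : ℕ) (f q : MvPolynomial (Fin n × Fin n) NNReal) (d : ℕ) (μ : Fin n × Fin n →₀ ℕ),
      f.IsHomogeneous d → (∀ m ∈ q.support, m + μ ∈ f.support) →
        ∀ m ∈ q.support, m.degree + μ.degree = d := by
  intro n f q d μ hf hext m hm
  have hdeg : (m + μ).degree = d := by
    rw [Finsupp.degree_eq_weight_one]
    exact hf (MvPolynomial.mem_support_iff.1 (hext m hm))
  rwa [map_add] at hdeg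

end Summit.ValiantsHypothesis.ValiantsHypothesis.Theorems
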